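import Literature.NumberTheory.Automorphic.ArchInnerFormChartOrbWeyl     -- ★ (LH3-p02 (g2)): `mem_chartTorusG_iff`, `chartTorusG_eq_range`; brings ★ `ArchInnerFormChartMeasures` (`chartTorusG`, `chartOrbG`), ★ atlas `gprimeBlock ∕ gprimeTorus`
import Literature.NumberTheory.Automorphic.ArchEndoscopicChartLocal       -- ★ p850034 (LH3-p03 (g3)): `chartBoxLoc`, `chartBox_eq_pi_chartBoxLoc` (the SAME local box on both sides)
import Literature.NumberTheory.Automorphic.ArchLocalRegularOrbitClosed    -- ★ `locallyCompactSpace_archLocal`, `secondCountableTopology_archLocal`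
import HarnessLib

/-!
# The ONE-PLACE `G′`-chart `gprimeBlockAt α w S′` and chart torus `T′_{S′,w} ≤ U(α)_w`; the `G′` chart torus `T_{S′}` is placewise
# ((PROD-QUOT-G′) FILE G1 of the LH3 direct road — the `G′`-side twin of ★ `ArchEndoscopicChartLocal`: Rogawski 1990 §3.6, §8.2; Shelstad 1979 §4; Borel–Jacquet 1979 §4.1)

Topic `NumberTheory/Automorphic`; namespace `Literature.NumberTheory.Automorphic.UnitaryGroup`.  DEFINITIONS WITH BODIES (`gprimeBlockAt`, `gprimeBlockAtHom`, `chartTorusGLoc`,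
`chartBoxImgGLoc`) + theorems; no instance, no notation, no axiom, no named fact, no `sorry`.  Cell `pub/hodgecm-mathlib`, crux H413 (`stmt-HodgeConjecture-24833`), F0∕P3c line LH3
(closer stub `stub_N9`, DIRECT ROAD), organ «(PROD-QUOT-G′)» (LH3-p03 (g3) offer 2026-09-02T07:36Z, the `G′`-side twin of (PROD-QUOT-H)): the factorisation of ★ `chartOrbG` of
`G′_∞ = U(diag α)(L⁺ ⊗ ℝ) ≃ Π_w U(σ_w diag α)(ℂ)` over the complex places — what (J-G′) needs to pin the jump datum `jc′ S w 0 2` on ONE product test function `a′ = ⊗_w a′_w` and to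
isolate the covered place `w` (then (J-DESC)∕(A0-b) act on `U(α)_w` alone).  THIS FILE: the local vocabulary (ONE place) — the local chart, its torus, the placewise structure of
★ `chartTorusG`; the local functional `chartOrbGLoc` and the factorisation are the sibling files `ArchInnerFormChartOrbLocal` ∕ `ArchInnerFormChartOrbPlaces`.  Count-neutral.

* §1 **`gprimeBlockAt L α w S′ cw : U(α)_w`** := ★ `gprimeBlock L α w S′ (fun _ => cw)` — the local chart (boost `gprimeSplitGL` at a split place `w ∈ S′ ∩ splitChartPlaces`, unit
  diagonal `gprimeCptGL` otherwise); `gprimeBlock_eq_gprimeBlockAt : gprimeBlock L α w S′ c = gprimeBlockAt L α w S′ (c w)` (rfl); `gprimeBlockAt_eq_archPiEquivCM_gprimeTorus`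
  (the local chart is the `w`-component of the global chart at the constant family) ⇒ additive, continuous, commuting (from ★ `gprimeTorus_add ∕ _zero ∕ continuous_gprimeTorus`,
  no case analysis redone); the hom `gprimeBlockAtHom`.
* §2 **`chartTorusGLoc L α S′ w ≤ U(α)_w`** := closure of the range of the local chart; closed, abelian, `≤` every centraliser of a local chart point
  (`forall_mem_chartTorusGLoc_comm`, the ★ `descConj` binder), locally compact, `continuous_descConj_gprimeBlockAt`; the local box image `chartBoxImgGLoc` (the image of the
  SAME local box ★ `chartBoxLoc L S′ w` as on the `H` side).  Under the frame hypotheses of ★ `mem_chartTorusG_iff` (`hα : ∀ i, α i ≠ 0`, `S′` admissible):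
  **`isClosed_range_gprimeBlockAtHom`**, **`chartTorusGLoc_eq_range`**, **`mem_chartTorusGLoc_iff : g ∈ T′_{S′,w} ↔ ∃ cw, gprimeBlockAt α w S′ cw = g`** — from the GLOBAL
  ★ `chartTorusG_eq_range` through the continuous insertion `g ↦ e⁻¹(mulSingle w g)` (`gprimeTorus_update_zero`).
* §3 **`mem_chartTorusG_iff_forall_mem_chartTorusGLoc (hα) (hS′) : t ∈ chartTorusG L α S′ ↔ ∀ w, (e t)_w ∈ chartTorusGLoc L α S′ w`** (`e = archPiEquivCM 3 L (diagonal α)`) —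
  the chart torus of `G′_∞` IS the product of the local tori (the `hmem` binder of ★ `exists_haar_homeomorph_map_quotientMeasure_pi`).
HONEST LABEL: HC_CM is proved only modulo the 7 printed citations (2 remaining: hLiu418 = `stmt-HodgeConjecture-24832`, h413 = `stmt-HodgeConjecture-24833`) until rung 0
closes; chart bookkeeping, moves no row of the books.

## References
* [Rogawski1990] J. D. Rogawski, *Automorphic Representations of Unitary Groups in Three Variables*, Ann. of Math. Stud. 123 (1990), §3.6 p. 31, §4.9 p. 54, §8.2 p. 122.
* [Shelstad1979] D. Shelstad, *Characters and inner forms of a quasi-split group over ℝ*, Compositio Math. 39 (1979), §4 pp. 22–23.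
* [Knapp1986] A. W. Knapp, *Representation Theory of Semisimple Groups* (1986), Ch. V §3 (Cartan subgroups of `SU(2,1)`).
* [BorelJacquet1979] A. Borel, H. Jacquet, *Automorphic forms and automorphic representations*, PSPM 33.1 (1979), §4.1 (`G_∞ = Π_v G(F_v)`).
-/

set_option autoImplicit false

noncomputable section

open NumberField NumberField.InfinitePlace Matrix Complex Topology
open Literature.MeasureTheory.Group
open scoped MatrixGroups Matrix Classical

namespace Literature.NumberTheory.Automorphic.UnitaryGroup

/-! ## §1 The local `G′`-chart `gprimeBlockAt α w S′` -/

section LocalChart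

variable (L : Type) [Field L] (α : Fin 3 → L) (w : {w : InfinitePlace L // IsComplex w}) (S' : Finset {w : InfinitePlace L // IsComplex w})

/-- **THE LOCAL `G′`-CHART `cw ↦ gprimeBlockAt α w S′ cw ∈ U(α)_w = U(σ_w diag α)(ℂ)`** — ★ `gprimeBlock` at the constant coordinate family: the boost `gprimeSplitGL` on the
plane `(lineOf s 0, lineOf s 2)` at a split place `w ∈ S′ ∩ splitChartPlaces`, the unit diagonal `gprimeCptGL (lineOf s)` otherwise. [cite: Rogawski1990, §3.6 p. 31]
[cite: Knapp1986, Ch. V §3] -/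
def gprimeBlockAt (cw : Fin 3 → ℝ) : ↥(archLocal L 3 (Matrix.diagonal α) w) :=
  gprimeBlock L α w S' (fun _ => cw)

/-- **The global chart's `w`-component IS the local chart at `c w`** (definitional: ★ `gprimeBlock` reads `c w` only). [cite: Rogawski1990, §3.6 p. 31] -/
theorem gprimeBlock_eq_gprimeBlockAt (c : {w : InfinitePlace L // IsComplex w} → Fin 3 → ℝ) : gprimeBlock L α w S' c = gprimeBlockAt L α w S' (c w) := rfl

variable [NumberField L] [IsCMField L]

/-- The local chart is the `w`-component of ★ `gprimeTorus` at the constant family. [cite: Rogawski1990, §3.6 p. 31] -/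
theorem gprimeBlockAt_eq_archPiEquivCM_gprimeTorus (cw : Fin 3 → ℝ) :
    gprimeBlockAt L α w S' cw = archPiEquivCM 3 L (Matrix.diagonal α) (gprimeTorus L α S' (fun _ => cw)) w := by
  rw [archPiEquivCM_gprimeTorus]; rfl

/-- **The local chart is additive** (★ `gprimeTorus_add` read at the place `w`). [cite: Rogawski1990, §3.6 p. 31] [cite: Knapp1986, Ch. V §3] -/
theorem gprimeBlockAt_add (cw cw' : Fin 3 → ℝ) : gprimeBlockAt L α w S' (cw + cw') = gprimeBlockAt L α w S' cw * gprimeBlockAt L α w S' cw' := by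
  have h := congrArg (fun g => archPiEquivCM 3 L (Matrix.diagonal α) g w) (gprimeTorus_add L α S' (fun _ => cw) (fun _ => cw'))
  simp only [map_mul, Pi.mul_apply, archPiEquivCM_gprimeTorus] at h
  exact h

/-- `gprimeBlockAt α w S′ 0 = 1` (★ `gprimeTorus_zero`). [cite: Rogawski1990, §3.6 p. 31] -/
theorem gprimeBlockAt_zero : gprimeBlockAt L α w S' 0 = 1 := by
  have h := congrArg (fun g => archPiEquivCM 3 L (Matrix.diagonal α) g w) (gprimeTorus_zero L α S')
  simp only [map_one, Pi.one_apply, archPiEquivCM_gprimeTorus] at h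
  exact h

/-- `gprimeBlockAt α w S′ (−cw) = (gprimeBlockAt α w S′ cw)⁻¹`. [cite: Rogawski1990, §3.6 p. 31] -/
theorem gprimeBlockAt_neg (cw : Fin 3 → ℝ) : gprimeBlockAt L α w S' (-cw) = (gprimeBlockAt L α w S' cw)⁻¹ := by
  have h := gprimeBlockAt_add L α w S' cw (-cw)
  rw [add_neg_cancel, gprimeBlockAt_zero] at h
  exact eq_inv_of_mul_eq_one_right h.symm

/-- **Local chart points commute.** [cite: Rogawski1990, §3.6 p. 31] -/
theorem gprimeBlockAt_comm (cw cw' : Fin 3 → ℝ) : gprimeBlockAt L α w S' cw * gprimeBlockAt L α w S' cw' = gprimeBlockAt L α w S' cw' * gprimeBlockAt L α w S' cw := by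
  rw [← gprimeBlockAt_add, ← gprimeBlockAt_add, add_comm]

/-- **The local chart is continuous** (★ `continuous_gprimeTorus` at the constant family, read at `w`). [cite: Rogawski1990, §3.6 p. 31] -/
theorem continuous_gprimeBlockAt : Continuous (gprimeBlockAt L α w S') := by
  have h : gprimeBlockAt L α w S' = fun cw => archPiEquivCM 3 L (Matrix.diagonal α) (gprimeTorus L α S' (fun _ => cw)) w :=
    funext fun cw => gprimeBlockAt_eq_archPiEquivCM_gprimeTorus L α w S' cw
  rw [h]
  exact (continuous_apply w).comp ((archPiEquivCM 3 L (Matrix.diagonal α)).continuous.comp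
    ((continuous_gprimeTorus L α S').comp (continuous_pi fun _ => continuous_id)))

/-- **The local chart as a monoid homomorphism** `Multiplicative (Fin 3 → ℝ) →* U(α)_w`. [cite: Rogawski1990, §3.6 p. 31] [cite: Shelstad1979, §4 p. 22] -/
def gprimeBlockAtHom : Multiplicative (Fin 3 → ℝ) →* ↥(archLocal L 3 (Matrix.diagonal α) w) where
  toFun cw := gprimeBlockAt L α w S' (Multiplicative.toAdd cw)
  map_one' := gprimeBlockAt_zero L α w S'
  map_mul' a b := gprimeBlockAt_add L α w S' (Multiplicative.toAdd a) (Multiplicative.toAdd b)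

/-- `gprimeBlockAtHom (ofAdd cw) = gprimeBlockAt cw` (definitional). [cite: Rogawski1990, §3.6 p. 31] -/
@[simp] theorem gprimeBlockAtHom_apply (cw : Multiplicative (Fin 3 → ℝ)) : gprimeBlockAtHom L α w S' cw = gprimeBlockAt L α w S' (Multiplicative.toAdd cw) := rfl

end LocalChart

/-! ## §2 The local chart torus `T′_{S′,w} ≤ U(α)_w` -/

section LocalTorus

variable (L : Type) [Field L] [NumberField L] [IsCMField L] (α : Fin 3 → L) (w : {w : InfinitePlace L // IsComplex w}) (S' : Finset {w : InfinitePlace L // IsComplex w})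

/-- **The local chart torus `T′_{S′,w} ≤ U(α)_w`** — the (closure of the) range of the local chart (as ★ `chartTorusG`): the fundamental noncompact Cartan of `U(α)_w ≅ U(2,1)` at a split
place of `S′`, the compact diagonal torus otherwise. [cite: Rogawski1990, §3.6 p. 31] [cite: Shelstad1979, §4 p. 22] -/
def chartTorusGLoc : Subgroup ↥(archLocal L 3 (Matrix.diagonal α) w) :=
  (gprimeBlockAtHom L α w S').range.topologicalClosure

/-- `T′_{S′,w}` is closed. [cite: Shelstad1979, §4 p. 22] -/
theorem isClosed_chartTorusGLoc : IsClosed (chartTorusGLoc L α w S' : Set ↥(archLocal L 3 (Matrix.diagonal α) w)) :=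
  Subgroup.isClosed_topologicalClosure _

/-- The range of the local chart lies in `T′_{S′,w}`. [cite: Rogawski1990, §3.6 p. 31] -/
theorem range_gprimeBlockAtHom_le_chartTorusGLoc : (gprimeBlockAtHom L α w S').range ≤ chartTorusGLoc L α w S' :=
  Subgroup.le_topologicalClosure _

/-- **Every local chart point lies in `T′_{S′,w}`.** [cite: Rogawski1990, §3.6 p. 31] -/
theorem gprimeBlockAt_mem_chartTorusGLoc (cw : Fin 3 → ℝ) : gprimeBlockAt L α w S' cw ∈ chartTorusGLoc L α w S' :=
  range_gprimeBlockAtHom_le_chartTorusGLoc L α w S' ⟨Multiplicative.ofAdd cw, rfl⟩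

/-- The `w`-component of every global chart point lies in `T′_{S′,w}`. [cite: Rogawski1990, §3.6 p. 31] -/
theorem gprimeBlock_mem_chartTorusGLoc (c : {w : InfinitePlace L // IsComplex w} → Fin 3 → ℝ) : gprimeBlock L α w S' c ∈ chartTorusGLoc L α w S' :=
  gprimeBlockAt_mem_chartTorusGLoc L α w S' (c w)

omit [NumberField L] [IsCMField L] in
/-- The centraliser of a point is closed. [folklore] -/
private theorem isClosed_centralizer_singleton_gloc {G : Type*} [Group G] [TopologicalSpace G] [IsTopologicalGroup G] [T2Space G] (t : G) :
    IsClosed (Subgroup.centralizer ({t} : Set G) : Set G) := by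
  have h : (Subgroup.centralizer ({t} : Set G) : Set G) = {g : G | t * g = g * t} := by
    ext g
    simp [Subgroup.mem_centralizer_iff]
  rw [h]
  exact isClosed_eq (continuous_const.mul continuous_id) (continuous_id.mul continuous_const)

/-- **`T′_{S′,w} ≤ Z(gprimeBlockAt α w S′ cw)` for EVERY `cw`.** [cite: Rogawski1990, §3.6 p. 31] -/
theorem chartTorusGLoc_le_centralizer (cw : Fin 3 → ℝ) :
    chartTorusGLoc L α w S' ≤ Subgroup.centralizer ({gprimeBlockAt L α w S' cw} : Set _) := by
  refine Subgroup.topologicalClosure_minimal _ ?_ (isClosed_centralizer_singleton_gloc _)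
  rintro _ ⟨a, rfl⟩
  rw [Subgroup.mem_centralizer_iff]
  rintro _ rfl
  rw [gprimeBlockAtHom_apply]
  exact gprimeBlockAt_comm L α w S' cw _

/-- **Every element of `T′_{S′,w}` commutes with every local chart point** — the binder of ★ `descConj (gprimeBlockAt α w S′ cw) T′_{S′,w} _`. [cite: Rogawski1990, §8.2 p. 122] -/
theorem forall_mem_chartTorusGLoc_comm (cw : Fin 3 → ℝ) :
    ∀ m ∈ chartTorusGLoc L α w S', m * gprimeBlockAt L α w S' cw = gprimeBlockAt L α w S' cw * m := fun _ hm =>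
  ((Subgroup.mem_centralizer_iff.mp (chartTorusGLoc_le_centralizer L α w S' cw hm)) _ rfl).symm

/-- The range of the local chart is commutative. [cite: Rogawski1990, §3.6 p. 31] -/
theorem range_gprimeBlockAtHom_mul_comm (a b : ↥(gprimeBlockAtHom L α w S').range) : a * b = b * a := by
  obtain ⟨a, x, rfl⟩ := a
  obtain ⟨b, y, rfl⟩ := b
  apply Subtype.ext
  simp only [Subgroup.coe_mul, gprimeBlockAtHom_apply]
  exact gprimeBlockAt_comm L α w S' _ _

/-- **`T′_{S′,w}` is abelian.** [cite: Rogawski1990, §3.6 p. 31] -/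
theorem chartTorusGLoc_mul_comm (a b : ↥(chartTorusGLoc L α w S')) : a * b = b * a :=
  (Subgroup.commGroupTopologicalClosure (gprimeBlockAtHom L α w S').range (range_gprimeBlockAtHom_mul_comm L α w S')).mul_comm a b

omit [NumberField L] [IsCMField L] in
/-- `U(α)_w` is locally compact. [cite: Folland1995, §2.2] -/
theorem locallyCompactSpace_archLocal_three : LocallyCompactSpace ↥(archLocal L 3 (Matrix.diagonal α) w) :=
  locallyCompactSpace_archLocal L 3 _ w

omit [NumberField L] [IsCMField L] in
/-- `U(α)_w` is second countable. [cite: Folland1995, §2.2] -/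
theorem secondCountableTopology_archLocal_three : SecondCountableTopology ↥(archLocal L 3 (Matrix.diagonal α) w) :=
  secondCountableTopology_archLocal L 3 _ w

/-- `T′_{S′,w}` is locally compact. [cite: Folland1995, §2.2] -/
theorem locallyCompactSpace_chartTorusGLoc : LocallyCompactSpace ↥(chartTorusGLoc L α w S') :=
  haveI := locallyCompactSpace_archLocal_three L α w
  (isClosed_chartTorusGLoc L α w S').isClosedEmbedding_subtypeVal.locallyCompactSpace

/-- The local orbital integrand `x T′ ↦ f (x · gprimeBlockAt cw · x⁻¹)` is continuous for continuous `f`. [cite: Rogawski1990, §8.3 p. 124] -/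
theorem continuous_descConj_gprimeBlockAt {Y : Type*} [TopologicalSpace Y] (f : ↥(archLocal L 3 (Matrix.diagonal α) w) → Y) (hf : Continuous f) (cw : Fin 3 → ℝ) :
    Continuous (descConj (gprimeBlockAt L α w S' cw) (chartTorusGLoc L α w S') (forall_mem_chartTorusGLoc_comm L α w S' cw) f) := by
  rw [(QuotientGroup.isQuotientMap_mk _).continuous_iff, descConj_comp_mk]
  exact hf.comp ((continuous_id.mul continuous_const).mul continuous_id.inv)

/-- **The local box image `B′_{S′,w} ⊆ T′_{S′,w}`** — the image of the SAME local box ★ `chartBoxLoc L S′ w` as on the `H` side (`x ∈ [0,1]` in slot `0` at `w ∈ S′`, angles in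
`[0, 2π]`); its Haar mass normalises the local functional. [cite: Rogawski1990, §8.2 p. 122] [cite: Folland1995, §2.2] -/
def chartBoxImgGLoc : Set ↥(chartTorusGLoc L α w S') :=
  (fun cw => (⟨gprimeBlockAt L α w S' cw, gprimeBlockAt_mem_chartTorusGLoc L α w S' cw⟩ : ↥(chartTorusGLoc L α w S'))) '' chartBoxLoc L S' w

/-- `B′_{S′,w}` is compact. [cite: Folland1995, §2.2] -/
theorem isCompact_chartBoxImgGLoc : IsCompact (chartBoxImgGLoc L α w S') :=
  (isCompact_chartBoxLoc L S' w).image ((continuous_gprimeBlockAt L α w S').subtype_mk _)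

/-- `1 ∈ B′_{S′,w}`. [cite: Folland1995, §2.2] -/
theorem one_mem_chartBoxImgGLoc : (1 : ↥(chartTorusGLoc L α w S')) ∈ chartBoxImgGLoc L α w S' :=
  ⟨0, zero_mem_chartBoxLoc L S' w, Subtype.ext (gprimeBlockAt_zero L α w S')⟩

/-- Membership in `B′_{S′,w}` read on `U(α)_w`. [cite: Folland1995, §2.2] -/
theorem mem_chartBoxImgGLoc_iff (t : ↥(chartTorusGLoc L α w S')) :
    t ∈ chartBoxImgGLoc L α w S' ↔ ∃ cw ∈ chartBoxLoc L S' w, gprimeBlockAt L α w S' cw = (t : ↥(archLocal L 3 (Matrix.diagonal α) w)) := by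
  constructor
  · rintro ⟨cw, hcw, rfl⟩
    exact ⟨cw, hcw, rfl⟩
  · rintro ⟨cw, hcw, h⟩
    exact ⟨cw, hcw, Subtype.ext h⟩

/-- The coordinate family supported at `w`: its global chart point is `e⁻¹(mulSingle w (gprimeBlockAt cw))`. [cite: Rogawski1990, §3.6 p. 31] -/
theorem gprimeTorus_update_zero (cw : Fin 3 → ℝ) :
    gprimeTorus L α S' (Function.update (0 : {w : InfinitePlace L // IsComplex w} → Fin 3 → ℝ) w cw) =
      (archPiEquivCM 3 L (Matrix.diagonal α)).symm (Pi.mulSingle w (gprimeBlockAt L α w S' cw)) := by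
  unfold gprimeTorus
  congr 1
  funext v
  by_cases hv : v = w
  · subst hv
    rw [Pi.mulSingle_eq_same, gprimeBlock_eq_gprimeBlockAt, Function.update_self]
  · rw [Pi.mulSingle_eq_of_ne hv, gprimeBlock_eq_gprimeBlockAt, Function.update_of_ne hv]
    exact gprimeBlockAt_zero L α v S'

/-- **THE RANGE OF THE LOCAL CHART IS CLOSED** (frame hypotheses of ★ `chartTorusG_eq_range`): the preimage of the closed range of the GLOBAL chart under the continuous insertion
`g ↦ e⁻¹(mulSingle w g)`. [cite: Shelstad1979, §4 p. 22] [cite: Rogawski1990, §3.6 p. 31] -/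
theorem isClosed_range_gprimeBlockAtHom (hα : ∀ i, α i ≠ 0) (hS' : ∀ w, w ∈ S' → w ∈ splitChartPlaces L α) :
    IsClosed ((gprimeBlockAtHom L α w S').range : Set ↥(archLocal L 3 (Matrix.diagonal α) w)) := by
  set ι : ↥(archLocal L 3 (Matrix.diagonal α) w) → ↥(arch (↥(maximalRealSubfield L)) L (IsCMField.complexConj L) 3 (Matrix.diagonal α)) :=
    fun g => (archPiEquivCM 3 L (Matrix.diagonal α)).symm (Pi.mulSingle w g) with hι
  have hιc : Continuous ι :=
    (archPiEquivCM 3 L _).symm.continuous.comp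
      (_root_.continuous_mulSingle (A := fun v : {w : InfinitePlace L // IsComplex w} => ↥(archLocal L 3 (Matrix.diagonal α) v)) w)
  have hset : ((gprimeBlockAtHom L α w S').range : Set _) = ι ⁻¹' ((gprimeTorusHom L α S').range : Set _) := by
    ext g
    simp only [SetLike.mem_coe, Set.mem_preimage, MonoidHom.mem_range, gprimeBlockAtHom_apply, gprimeTorusHom_apply]
    constructor
    · rintro ⟨a, rfl⟩
      exact ⟨Multiplicative.ofAdd (Function.update (0 : {w : InfinitePlace L // IsComplex w} → Fin 3 → ℝ) w (Multiplicative.toAdd a)), gprimeTorus_update_zero L α w S' _⟩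
    · rintro ⟨a, ha⟩
      refine ⟨Multiplicative.ofAdd ((Multiplicative.toAdd a) w), ?_⟩
      have h1 := congrArg (fun h => archPiEquivCM 3 L (Matrix.diagonal α) h w) ha
      simp only [hι, archPiEquivCM_gprimeTorus, ContinuousMulEquiv.apply_symm_apply, Pi.mulSingle_eq_same] at h1
      rw [← h1, gprimeBlock_eq_gprimeBlockAt]
      rfl
  rw [hset, ← chartTorusG_eq_range L α S' hα hS']
  exact (isClosed_chartTorusG L α S').preimage hιc

/-- **`chartTorusGLoc` IS THE RANGE OF THE LOCAL CHART** (frame hypotheses). [cite: Shelstad1979, §4 p. 22] -/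
theorem chartTorusGLoc_eq_range (hα : ∀ i, α i ≠ 0) (hS' : ∀ w, w ∈ S' → w ∈ splitChartPlaces L α) :
    chartTorusGLoc L α w S' = (gprimeBlockAtHom L α w S').range :=
  le_antisymm (Subgroup.topologicalClosure_minimal _ le_rfl (isClosed_range_gprimeBlockAtHom L α w S' hα hS')) (range_gprimeBlockAtHom_le_chartTorusGLoc L α w S')

/-- **Every element of `T′_{S′,w}` is a local chart point** (frame hypotheses). [cite: Rogawski1990, §3.6 p. 31] -/
theorem mem_chartTorusGLoc_iff (hα : ∀ i, α i ≠ 0) (hS' : ∀ w, w ∈ S' → w ∈ splitChartPlaces L α) (g : ↥(archLocal L 3 (Matrix.diagonal α) w)) :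
    g ∈ chartTorusGLoc L α w S' ↔ ∃ cw : Fin 3 → ℝ, gprimeBlockAt L α w S' cw = g := by
  rw [chartTorusGLoc_eq_range L α w S' hα hS']
  exact ⟨fun ⟨a, ha⟩ => ⟨Multiplicative.toAdd a, ha⟩, fun ⟨cw, hcw⟩ => ⟨Multiplicative.ofAdd cw, hcw⟩⟩

/-! ## §3 The `G′` chart torus is placewise -/

/-- **THE `G′` CHART TORUS IS THE PRODUCT OF THE LOCAL TORI** (frame hypotheses): `t ∈ T_{S′} ↔ ∀ w, (e t)_w ∈ T′_{S′,w}`. [cite: Rogawski1990, §3.6 p. 31] [cite: BorelJacquet1979, §4.1] -/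
theorem mem_chartTorusG_iff_forall_mem_chartTorusGLoc (hα : ∀ i, α i ≠ 0) (hS' : ∀ w, w ∈ S' → w ∈ splitChartPlaces L α)
    (t : ↥(arch (↥(maximalRealSubfield L)) L (IsCMField.complexConj L) 3 (Matrix.diagonal α))) :
    t ∈ chartTorusG L α S' ↔ ∀ v : {w : InfinitePlace L // IsComplex w}, archPiEquivCM 3 L (Matrix.diagonal α) t v ∈ chartTorusGLoc L α v S' := by
  rw [mem_chartTorusG_iff L α S' hα hS']
  constructor
  · rintro ⟨c, rfl⟩ v
    rw [archPiEquivCM_gprimeTorus]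
    exact gprimeBlock_mem_chartTorusGLoc L α v S' c
  · intro ht
    have hc : ∀ v : {w : InfinitePlace L // IsComplex w}, ∃ cw : Fin 3 → ℝ, gprimeBlockAt L α v S' cw = archPiEquivCM 3 L (Matrix.diagonal α) t v := fun v =>
      (mem_chartTorusGLoc_iff L α v S' hα hS' _).1 (ht v)
    choose cw hcw using hc
    refine ⟨fun v => cw v, ?_⟩
    apply (archPiEquivCM 3 L (Matrix.diagonal α)).injective
    funext v
    rw [archPiEquivCM_gprimeTorus, gprimeBlock_eq_gprimeBlockAt]
    exact hcw v

end LocalTorus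

end Literature.NumberTheory.Automorphic.UnitaryGroup

end
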